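import Mathlib
import HarnessLib
import HarnessLib.Audit
import Summits.PneNP.PneNP.Theses.PrimalityPlaces
import Literature.Computability.MetaComplexity.EFSoundness
import Literature.Computability.MetaComplexity.BoundedArithSForm
import Literature.Computability.MetaComplexity.BoundedArithStandardModel

/-!
# Line `birth` — BC3 skeleton for the crux `EFPrimalityHard` (stmt-PneNP-16927)

Route `PrimalityPlaces` (route-PneNP-PrimalityPlaces), crux (rank 6) `EFPrimalityHard` = EF NEEDS
SUCCINCT COUNTING FOR PRIMES: for every Frege system `F` and every `k`, for infinitely many `n` there is
an `n`-bit prime `p` such that every extended-Frege proof over `F` of `¬ primeCNF n p` (the route's inlined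
array-multiplier translation `σₙ(p)` of Krajíček–Pudlák's `¬Composite(p)`) has size `> n ^ k`.

THE LINE = THE ROUTE'S OWN FORESEEN SPLIT (route header, TWO-LAYER PLAN: "EFPrimalityHard ⇐ (uniform
form …, KP98 Thm 12 direction) → …"), i.e. KRAJÍČEK–PUDLÁK'S THEOREM 12 [KrajicekPudlak1998, §4, Thm. 12,
direction (2) ⇒ (1)] cut into its two genuine ingredients plus the uniform open core:

* `stub_efReflectionS12` — EF-REFLECTION FOR THE PRIMES FAMILY INSIDE `S¹₂` (known, size L–XL): for every
  Frege `F` and `k` there is a `Σᵇ₁` formula `E(a)` of Buss's language which MEANS (in `ℕ`) "`σ_{|a|}(a)` has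
  an `EF_F`-proof of symbol size `≤ |a| ^ k`" and whose SOUNDNESS `S¹₂` PROVES: `S₂¹ ⊨ E(a) → ¬Composite(a)`.
  Ingredients: arithmetisation of `F.IsEFProofOf` by a polynomial-time predicate, hence `Σᵇ₁`-definable in
  `S₂¹` (Buss 1986, Ch. 3; in the tree `GDef.ofPolyTime` / `S2Machine.machineG`, pattern of
  `bussSatFormula`); the reflection principle `S₂¹ ⊢ 0-RFN(EF)` (Cook 1975 for `PV ⊢ RFN(ER)`, Buss 1986;
  Krajíček 1995, §9.3); and `S₂¹`-provable correctness of the route's array multiplier (a `Δᵇ₁`-PIND on rows):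
  from a factorisation `u · v = a`, `u, v < a`, `S₂¹` builds the assignment satisfying `primeCNF |a| a`,
  contradicting the reflected tautology.
* `stub_soundPrimesDefOfShortProofs` — PATCHING TO AN EXACT NP-DEFINITION OF PRIMES (provable-now modulo
  the route's support `PrimeCNFCorrect` and EF soundness/completeness, size M): if for SOME `k` all primes of
  every bit-length `n ≥ N₀` have `EF_F`-proofs of `σₙ(p)` of size `≤ n ^ k`, and reflection formulas `E_k` as
  above exist for EVERY `k`, then some `Σᵇ₁` formula `A(a)` defines EXACTLY the primes in `ℕ` and
  `S₂¹ ⊨ A(a) → ¬Composite(a)` — take `A := (E_{k'}(a) ∧ 2 ≤ a)` for `k' ≥ k` large enough to cover the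
  finitely many primes below `2^{N₀}` (every tautology has SOME `EF_F`-proof: `isEFProvable_iff_isTautology`),
  or patch them in as numerals; `E(a) ∧ 2 ≤ a ⇒ a` prime uses EF soundness
  (`IsSound.isTautology_of_isEFProofOf`) and the satisfiable direction of the multiplier encoding; for a prime
  `a` of bit-length `n = Nat.size a` one has `2^(n-1) ≤ a < 2^n`.
* `stub_noS12SoundPrimesDef` — THE UNIFORM CORE (open; = ¬(1) of KP98 Thm. 12, Krajíček–Pudlák's §4
  problem in its bounded-arithmetic form): NO `Σᵇ₁` (NP-) definition of the set of primes has
  `S₂¹`-provable soundness. Status in print: upper bounds only — Pratt soundness in `S₂¹ + dWPHP(PV)`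
  (Jeřábek, cf. [KrajicekProofComplexity2019, §18.8 p. 402]); AKS correctness in `VTC⁰₂ / T₂^count`
  (Jalali–Ježil 2026, doi:10.1017/fms.2026.10194); `S₂¹` itself OPEN; conditional evidence for ONE
  definition: `S₂¹`-provable soundness of Pratt ⇒ discrete log implicitly definable [KrajicekPudlak1998, §2].
* the SEAM `efPrimalityHard_of_sigs : Sig₁ → Sig₂ → Sig₃ → <crux body verbatim>` — sorry-free classical
  logic: if the crux failed for `F, k, N₀`, every large prime has a short proof (the crux body is unfolded
  through its fifteen `let`s, which are copied VERBATIM into `sigmaForm`), stub 1 + stub 2 give an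
  `S₂¹`-provably sound NP-definition of the primes, contradicting stub 3; and THE SKELETON THEOREM
  `EFPrimalityHard_of : EFPrimalityHard` — the crux BY NAME from the three stubs (the file's only `sorry`s),
  the file's only theorem whose head is the crux name (what `ledger skeleton check` keys on).

WHY EASIER / TRANSFER (for stub 3, honestly): by KP98 Thm. 12 the uniform core is EQUIVALENT to the
non-uniform crux (modulo stubs 1–2 and the converse translation `S₂¹`-proof ↦ p-size EF proofs), so no
strength is gained; what is gained is LANGUAGE: the statement is about ONE theory and admits the tools of
bounded arithmetic — model constructions (a model of `S₂¹` with a composite `a` satisfying `A(a)`),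
Parikh/KPT/Buss witnessing applied to auxiliary `∀Σᵇ₁` consequences, Jeřábek's analysis of where `dWPHP`
enters Pratt/AKS soundness — which is where ALL partial results on `σ_p` live (none exist on the
propositional side: "We do not know any lower bounds for the tautologies in any proof system", KP98 §4).

Disproof used: none exists for this crux (`ledger crux ls stmt-PneNP-16927`: no workfiles, no Disproof.lean,
no crux ideas, 2026-08-17). Negatives honoured: `ledger negatives --problem PneNP` — no statement about EF,
`S₂¹` or primality tautologies; no stub is an instance of a refuted statement. Barrier respected:
`Literature.Barriers.PneNP.FeasibleInterpolationEF` (KP98 Cor. 10) — no stub argues via interpolation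
(`σ_p` is not a split formula); the line goes through reflection/witnessing, the barrier-free side of KP98.
BC3 probes (seat folder `bc/probe_*.lean`): `stub → EFPrimalityHard` and `stub → PneNP` by
`first | exact? | simpa | aesop` FAIL for all three stubs (outputs in the seat's NOTES.md and `Lines/birth.md`).
Planner planner-skel-stmt-PneNP-16927-0, 2026-08-17.
-/

set_option linter.dupNamespace false
set_option linter.unusedVariables false

namespace Summit.PneNP.PneNP.Cruxes.EFPrimalityHard.Birth

open Literature.Computability.Complexity
open Literature.Computability.MetaComplexity
open Summit.PneNP.PneNP.Theses.PrimalityPlaces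

/-! ## Vocabulary of the line (definitions, no content) -/

/-- The route's primality tautology `σₙ(p) := ¬ primeCNF n p` as a NAMED formula: the fifteen `let`s of the
crux `EFPrimalityHard` copied VERBATIM (array multiplier on `n`-bit `x, y`, output bits fixed to `p`, wide
clauses `x ≠ 1`, `y ≠ 1`), so that `sigmaForm n p` is definitionally the formula inside the crux.
[cite: KrajicekPudlak1998, §4 (the tautologies σ_p)] -/
def sigmaForm (n p : ℕ) : PropForm ℕ :=
  let X : ℕ → ℕ := fun i => i; let Y : ℕ → ℕ := fun j => n + j; let PP : ℕ → ℕ → ℕ := fun i j => 2 * n + i * n + j; let S : ℕ → ℕ → ℕ := fun i k => 2 * n + n * n + i * (2 * n) + k; let C : ℕ → ℕ → ℕ := fun i j => 2 * n + 3 * (n * n) + i * (n + 1) + j; let Z0 : ℕ := 3 * n + 4 * (n * n); let acc : ℕ → ℕ → ℕ := fun i k => if i = 0 then (if k < n then PP 0 k else Z0) else if k = 0 then PP 0 0 else if k < i then S k k else if k < n + i then S i k else C i n; let cin : ℕ → ℕ → ℕ := fun i j => if j = 0 then Z0 else C i j; let andCl : ℕ → ℕ → ℕ → Literature.Computability.Complexity.CNF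 ℕ := fun z a b => [[(z, false), (a, true)], [(z, false), (b, true)], [(z, true), (a, false), (b, false)]]; let xorCl : ℕ → ℕ → ℕ → ℕ → Literature.Computability.Complexity.CNF ℕ := fun s a b c => [[(a, false), (b, true), (c, true), (s, true)], [(a, true), (b, false), (c, true), (s, true)], [(a, true), (b, true), (c, false), (s, true)], [(a, true), (b, true), (c, true), (s, false)], [(a, false), (b, false), (c, false), (s, true)], [(a, false), (b, false), (c, true), (s, false)], [(a, false), (b, true), (c, false), (s, false)], [(a, true), (b, false), (c, false), (s, false)]]; let majCl : ℕ → ℕ → ℕ → ℕ → Literature.Computability.Complexity.CNF ℕ := fun m a b c => [[(m, false), (a, true), (b, true)], [(m, false), (a, true), (c, true)], [(m, false), (b, true), (c, true)], [(m, true), (a, false), (b, false)], [(m, true), (a, false), (c, false)], [(m, true), (b, false), (c, false)]]; let mulCNF : Literature.Computability.Complexity.CNF ℕ := [[(Z0, false)]] ++ ((List.range n).flatMap fun i => (List.range n).flatMap fun j => andCl (PP i j) (X i) (Y j)) ++ ((List.range n).flatMap fun i => if i = 0 then [] else (List.range n).flatMap fun j => xorCl (S i (i + j)) (acc (i - 1)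 (i + j)) (PP i j) (cin i j) ++ majCl (C i (j + 1)) (acc (i - 1) (i + j)) (PP i j) (cin i j)); let Z : ℕ → ℕ := fun k => acc (n - 1) k; let outCl : ℕ → Literature.Computability.Complexity.CNF ℕ := fun p => (List.range (2 * n)).map fun k => [(Z k, Nat.testBit p k)]; let primeCNF : ℕ → Literature.Computability.Complexity.CNF ℕ := fun p => mulCNF ++ outCl p ++ [((X 0, false) :: (List.range (n - 1)).map fun i => (X (i + 1), true)), ((Y 0, false) :: (List.range (n - 1)).map fun j => (Y (j + 1), true))]; Literature.Computability.Complexity.PropForm.neg (Literature.Computability.Complexity.PropForm.ofCNF (primeCNF p))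

/-- Krajíček–Pudlák's `Composite(a) :≡ ∃ x, y < a (x · y = a)` [KrajicekPudlak1998, §1, before Prop. 2], as
a named-variable bounded formula of Buss's language (`SForm 1`, free variable `a = x₀`; bound `x₁, x₂ ≤ a`
with `x₁ < a`, `x₂ < a`, `x₁ · x₂ = a`). [cite: KrajicekPudlak1998, §1] -/
def compositeS : SForm 1 :=
  SForm.bex (FirstOrder.Language.Term.var 0) <|
    SForm.bex (FirstOrder.Language.Term.var 0) <|
      SForm.and (SForm.lt (FirstOrder.Language.Term.var 1) (FirstOrder.Language.Term.var 0)) <|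
        SForm.and (SForm.lt (FirstOrder.Language.Term.var 2) (FirstOrder.Language.Term.var 0)) <|
          SForm.eq (FirstOrder.Language.Term.var 1 * FirstOrder.Language.Term.var 2)
            (FirstOrder.Language.Term.var 0)

/-- `Composite(a)` as a Mathlib first-order formula with the single free variable `a : Fin 1`.
[cite: KrajicekPudlak1998, §1] -/
def compositeFormula : FirstOrder.Language.boundedArith.Formula (Fin 1) :=
  compositeS.toFormula

/-- `Composite(a)` is syntactically `Σᵇ₁` (two bounded `∃` over an open matrix). [cite: Buss1986, §2.1] -/
theorem isSigmab_compositeFormula : IsSigmab 1 compositeFormula :=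
  SForm.isSigmab_toFormula (by decide)

/-- Semantics of `Composite(a)` in the standard model: some `x, y < a` have `x · y = a` (hence `¬Composite(a)`
iff `a` is prime or `a ≤ 1`) — the definitions compute (BC5-type sanity; `SForm.realize_toFormula`).
[cite: KrajicekPudlak1998, §1] -/
theorem realize_compositeFormula (a : ℕ) :
    compositeFormula.Realize ![a] ↔ ∃ x < a, ∃ y < a, x * y = a := by
  rw [compositeFormula, SForm.realize_toFormula]
  simp only [compositeS, SForm.realize_bex, SForm.realize_and, SForm.realize_lt, SForm.realize_eq, mLe_nat,
    not_le]
  constructor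
  · rintro ⟨x, -, y, -, hx, hy, h⟩
    exact ⟨x, by simpa using hx, y, by simpa using hy, by simpa using h⟩
  · rintro ⟨x, hx, y, hy, h⟩
    exact ⟨x, by simpa using hx.le, y, by simpa using hy.le, by simpa using hx, by simpa using hy, by simpa using h⟩

example : compositeFormula.Realize ![6] := (realize_compositeFormula 6).2 ⟨2, by decide, 3, by decide, rfl⟩
example : ¬ compositeFormula.Realize ![7] := fun h => by
  obtain ⟨x, hx, y, hy, hxy⟩ := (realize_compositeFormula 7).1 h
  interval_cases x <;> interval_cases y <;> omega

/-- `S₂¹ ⊢ A(a) → ¬Composite(a)`: the soundness of a candidate definition `A` of primality is a CONSEQUENCE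
of Buss's `S₂¹` — Mathlib's semantic consequence `Theory.ModelsBoundedFormula` (`S2 1 ⊨ᵇ A ⟹ ∼Composite`,
free variable `a` read universally, all models of `S2 1`), which is first-order provability by
completeness. [cite: KrajicekPudlak1998, §4 Thm. 12 (1)(b)] [cite: Buss1986, §2.4] -/
def S12ProvesSound (A : FirstOrder.Language.boundedArith.Formula (Fin 1)) : Prop :=
  FirstOrder.Language.Theory.ModelsBoundedFormula (S2 1)
    (FirstOrder.Language.BoundedFormula.imp A (FirstOrder.Language.BoundedFormula.not compositeFormula))

/-- AN `S₂¹`-PROVABLY SOUND NP-DEFINITION OF THE PRIMES (condition (1) of [KrajicekPudlak1998, Thm. 12]):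
a `Σᵇ₁` formula `A(a)` of Buss's language such that (a) `{p ∈ ℕ | ℕ ⊨ A(p)}` is the set of primes and
(b) `S₂¹ ⊢ A(a) → ¬Composite(a)`. [cite: KrajicekPudlak1998, §4 Thm. 12 (1)] -/
def IsS12SoundPrimesDef (A : FirstOrder.Language.boundedArith.Formula (Fin 1)) : Prop :=
  IsSigmab 1 A ∧ (∀ a : ℕ, A.Realize ![a] ↔ a.Prime) ∧ S12ProvesSound A

/-! ## The three registered stubs -/

/-- **Stub 1 — EF-reflection for the primes family inside `S₂¹`** (known; [KrajicekPudlak1998, proof of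
Thm. 12, (2) ⇒ (1)]: "S¹₂ proves the soundness of EF"; Cook 1975 / Buss 1986 / Krajíček 1995 §9.3 for
`S₂¹ ⊢ 0-RFN(EF)`; Buss 1986 Ch. 3 for `Σᵇ₁`-definability of polynomial-time predicates; size L–XL).
For every Frege system `F` and exponent `k` there is a `Σᵇ₁` formula `E(a)` such that, in `ℕ`, `E(a)` holds
iff `σ_{|a|}(a)` has an extended-Frege proof over `F` of symbol size `≤ |a| ^ k` (`|a| = Nat.size a`), and
`S₂¹ ⊨ E(a) → ¬Composite(a)`. [cite: KrajicekPudlak1998, §4 Thm. 12] [cite: Buss1986, Ch. 3]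
[cite: Krajicek1995, §9.3] -/
theorem stub_efReflectionS12 :
    ∀ F : FregeSystem, IsFrege F → ∀ k : ℕ,
      ∃ E : FirstOrder.Language.boundedArith.Formula (Fin 1), IsSigmab 1 E ∧
        (∀ a : ℕ, E.Realize ![a] ↔
          ∃ π : List (PropForm ℕ), F.IsEFProofOf π (sigmaForm (Nat.size a) a) ∧
            proofSize π ≤ Nat.size a ^ k) ∧
        S12ProvesSound E := by
  sorry

/-- **Stub 2 — patching short proofs + reflection formulas into an exact sound NP-definition of PRIMES**
(the bookkeeping half of [KrajicekPudlak1998, Thm. 12, (2) ⇒ (1)], size M: needs EF soundness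
`FregeSystem.IsSound.isTautology_of_isEFProofOf`, EF completeness `isEFProvable_iff_isTautology` for the
finitely many primes below `2 ^ N₀` (or numerals), the satisfiable direction of the route's support
`PrimeCNFCorrect`, `Σᵇ₁` closure under `∧` (`IsSigmab.inf`), and `2^(n-1) ≤ a < 2^n ↔ Nat.size a = n`).
If all primes of every bit-length `n ≥ N₀` have `EF_F`-proofs of `σₙ(p)` of size `≤ n ^ k`, and for every
exponent a `Σᵇ₁` reflection formula with `S₂¹`-provable soundness exists, then the primes have an
`S₂¹`-provably sound `Σᵇ₁` definition. [cite: KrajicekPudlak1998, §4 Thm. 12] [cite: CookReckhow1979, Prop. 4.2] -/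
theorem stub_soundPrimesDefOfShortProofs :
    ∀ F : FregeSystem, IsFrege F → ∀ k N₀ : ℕ,
      (∀ n ≥ N₀, ∀ p : ℕ, p.Prime → 2 ^ (n - 1) ≤ p → p < 2 ^ n →
        ∃ π : List (PropForm ℕ), F.IsEFProofOf π (sigmaForm n p) ∧ proofSize π ≤ n ^ k) →
      (∀ k' : ℕ, ∃ E : FirstOrder.Language.boundedArith.Formula (Fin 1), IsSigmab 1 E ∧
        (∀ a : ℕ, E.Realize ![a] ↔
          ∃ π : List (PropForm ℕ), F.IsEFProofOf π (sigmaForm (Nat.size a) a) ∧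
            proofSize π ≤ Nat.size a ^ k') ∧
        S12ProvesSound E) →
      ∃ A : FirstOrder.Language.boundedArith.Formula (Fin 1), IsS12SoundPrimesDef A := by
  sorry

/-- **Stub 3 — the uniform core: no NP-definition of primality has `S₂¹`-provable soundness** (OPEN:
the negation of condition (1) of [KrajicekPudlak1998, Thm. 12], i.e. Krajíček–Pudlák's closing problem
"Do the tautologies σ_p admit polynomial size EF-proofs?" in its bounded-arithmetic form; known upper bounds
`S₂¹ + dWPHP(PV)` (Pratt, Jeřábek) and `T₂^count` (AKS, Jalali–Ježil 2026) lie strictly above `S₂¹`).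
For every `Σᵇ₁` formula `A(a)` defining exactly the primes in `ℕ`, `S₂¹ ⊭ A(a) → ¬Composite(a)`.
[cite: KrajicekPudlak1998, §4 Thm. 12 and Problem] [cite: KrajicekProofComplexity2019, §18.8]
[cite: doi:10.1017/fms.2026.10194] -/
theorem stub_noS12SoundPrimesDef :
    ¬ ∃ A : FirstOrder.Language.boundedArith.Formula (Fin 1), IsS12SoundPrimesDef A := by
  sorry

/-! ## The composition (sorry-free) -/

/-- **Composition with explicit hypotheses** (BC3 shape `Sig₁ → Sig₂ → Sig₃ → crux`; the conclusion is the
crux's body VERBATIM, so that `EFPrimalityHard_of` below is the file's only theorem whose head is the crux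
name — what `ledger skeleton check` keys on). Classical logic: were the crux false at `F, k, N₀`, every prime
of every bit-length `n ≥ N₀` would have an `EF_F`-proof of `σₙ(p)` of size `≤ n ^ k` (the crux body, seen
through its fifteen `let`s, is literally `∀ π, F.IsEFProofOf π (sigmaForm n p) → n ^ k < proofSize π`);
stubs 1–2 then produce an `S₂¹`-provably sound NP-definition of the primes, which stub 3 forbids.
[cite: KrajicekPudlak1998, §4 Thm. 12] -/
theorem efPrimalityHard_of_sigs
    (h₁ : ∀ F : FregeSystem, IsFrege F → ∀ k : ℕ,
      ∃ E : FirstOrder.Language.boundedArith.Formula (Fin 1), IsSigmab 1 E ∧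
        (∀ a : ℕ, E.Realize ![a] ↔
          ∃ π : List (PropForm ℕ), F.IsEFProofOf π (sigmaForm (Nat.size a) a) ∧
            proofSize π ≤ Nat.size a ^ k) ∧
        S12ProvesSound E)
    (h₂ : ∀ F : FregeSystem, IsFrege F → ∀ k N₀ : ℕ,
      (∀ n ≥ N₀, ∀ p : ℕ, p.Prime → 2 ^ (n - 1) ≤ p → p < 2 ^ n →
        ∃ π : List (PropForm ℕ), F.IsEFProofOf π (sigmaForm n p) ∧ proofSize π ≤ n ^ k) →
      (∀ k' : ℕ, ∃ E : FirstOrder.Language.boundedArith.Formula (Fin 1), IsSigmab 1 E ∧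
        (∀ a : ℕ, E.Realize ![a] ↔
          ∃ π : List (PropForm ℕ), F.IsEFProofOf π (sigmaForm (Nat.size a) a) ∧
            proofSize π ≤ Nat.size a ^ k') ∧
        S12ProvesSound E) →
      ∃ A : FirstOrder.Language.boundedArith.Formula (Fin 1), IsS12SoundPrimesDef A)
    (h₃ : ¬ ∃ A : FirstOrder.Language.boundedArith.Formula (Fin 1), IsS12SoundPrimesDef A) :
    ∀ F : Literature.Computability.MetaComplexity.FregeSystem, Literature.Computability.MetaComplexity.IsFrege F → ∀ k N₀ : ℕ, ∃ n ≥ N₀, ∃ p : ℕ, p.Prime ∧ 2 ^ (n - 1) ≤ p ∧ p < 2 ^ n ∧ (let X : ℕ → ℕ := fun i => i; let Y : ℕ → ℕ := fun j => n + j; let PP : ℕ → ℕ → ℕ := fun i j => 2 * n + i * n + j; let S : ℕ → ℕ → ℕ := fun i k => 2 * n + n * n + i * (2 * n) + k; let C : ℕ → ℕ → ℕ := fun i j => 2 * n + 3 * (n * n) + i * (n + 1) + j; let Z0 : ℕ := 3 * n + 4 * (n * n); let acc : ℕ → ℕ → ℕ := fun i k => if i = 0 then (if k < n then PP 0 k else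 Z0) else if k = 0 then PP 0 0 else if k < i then S k k else if k < n + i then S i k else C i n; let cin : ℕ → ℕ → ℕ := fun i j => if j = 0 then Z0 else C i j; let andCl : ℕ → ℕ → ℕ → Literature.Computability.Complexity.CNF ℕ := fun z a b => [[(z, false), (a, true)], [(z, false), (b, true)], [(z, true), (a, false), (b, false)]]; let xorCl : ℕ → ℕ → ℕ → ℕ → Literature.Computability.Complexity.CNF ℕ := fun s a b c => [[(a, false), (b, true), (c, true), (s, true)], [(a, true), (b, false), (c, true), (s, true)], [(a, true), (b, true), (c, false), (s, true)], [(a, true), (b, true), (c, true), (s, false)], [(a, false), (b, false), (c, false), (s, true)], [(a, false), (b, false), (c, true), (s, false)], [(a, false), (b, true), (c, false), (s, false)], [(a, true), (b, false), (c, false), (s, false)]]; let majCl : ℕ → ℕ → ℕ → ℕ → Literature.Computability.Complexity.CNF ℕ := fun m a b c => [[(m, false), (a, true), (b, true)], [(m, false), (a, true), (c, true)], [(m, false), (b, true), (c, true)], [(m, true), (a, false), (b, false)], [(m, true), (a, false), (c, false)], [(m, true), (b, false), (c, false)]]; let mulCNF : Literature.Computability.Complexity.CNF ℕ := [[(Z0,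 false)]] ++ ((List.range n).flatMap fun i => (List.range n).flatMap fun j => andCl (PP i j) (X i) (Y j)) ++ ((List.range n).flatMap fun i => if i = 0 then [] else (List.range n).flatMap fun j => xorCl (S i (i + j)) (acc (i - 1) (i + j)) (PP i j) (cin i j) ++ majCl (C i (j + 1)) (acc (i - 1) (i + j)) (PP i j) (cin i j)); let Z : ℕ → ℕ := fun k => acc (n - 1) k; let outCl : ℕ → Literature.Computability.Complexity.CNF ℕ := fun p => (List.range (2 * n)).map fun k => [(Z k, Nat.testBit p k)]; let primeCNF : ℕ → Literature.Computability.Complexity.CNF ℕ := fun p => mulCNF ++ outCl p ++ [((X 0, false) :: (List.range (n - 1)).map fun i => (X (i + 1), true)), ((Y 0, false) :: (List.range (n - 1)).map fun j => (Y (j + 1), true))]; ∀ π : List (Literature.Computability.Complexity.PropForm ℕ), F.IsEFProofOf π (Literature.Computability.Complexity.PropForm.neg (Literature.Computability.Complexity.PropForm.ofCNF (primeCNF p))) → n ^ k < Literature.Computability.MetaComplexity.proofSize π) := by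
  intro F hF k N₀
  by_contra hcon
  have short : ∀ n ≥ N₀, ∀ p : ℕ, p.Prime → 2 ^ (n - 1) ≤ p → p < 2 ^ n →
      ∃ π : List (PropForm ℕ), F.IsEFProofOf π (sigmaForm n p) ∧ proofSize π ≤ n ^ k := by
    intro n hn p hp hlo hhi
    by_contra hno
    refine hcon ⟨n, hn, p, hp, hlo, hhi, ?_⟩
    intro X Y PP S C Z0 acc cin andCl xorCl majCl mulCNF Z outCl primeCNF π hπ
    exact Nat.lt_of_not_le fun hle => hno ⟨π, hπ, hle⟩
  exact h₃ (h₂ F hF k N₀ short fun k' => h₁ F hF k')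

/-- **THE SKELETON THEOREM.** The crux `Summit.PneNP.PneNP.Theses.PrimalityPlaces.EFPrimalityHard`, concluded
BY NAME from the three DECLARED stubs `stub_efReflectionS12`, `stub_soundPrimesDefOfShortProofs`,
`stub_noS12SoundPrimesDef` (the only `sorry`s of the file) through the sorry-free composition
`efPrimalityHard_of_sigs`. [cite: KrajicekPudlak1998, §4 Thm. 12] -/
theorem EFPrimalityHard_of : Summit.PneNP.PneNP.Theses.PrimalityPlaces.EFPrimalityHard :=
  efPrimalityHard_of_sigs stub_efReflectionS12 stub_soundPrimesDefOfShortProofs stub_noS12SoundPrimesDef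

end Summit.PneNP.PneNP.Cruxes.EFPrimalityHard.Birth
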